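import Literature.AlgebraicGeometry.Frobenioids.UnitTrivializationPerfectionModelSchema
import Literature.AlgebraicGeometry.Frobenioids.UnitTrivializationPerfectionModelElem
import Literature.AlgebraicGeometry.Frobenioids.UnitTrivializationPerfectionModelHolds
import HarnessLib

/-!
# Frobenioids I, Prop. 5.3: `(C^un-tr)^pf` IS the model Frobenioid of (`Φ^pf`, `ℚ · Φ^birat`) in abc-iut-L1-t5's
# LITERAL rendering `untrPfModel F` — compatibly with the functors to `F_{Φ^pf}` (proof-only)

Mochizuki, *The geometry of Frobenioids I: the general theory*, Kyushu J. Math. **62** (2008) 293–400, §5,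
Proposition 5.3 p. 103 ll. 18–21 (kurims render, running head counted) [cite: MochizukiFrdI2008, Prop. 5.3 p.103]: "Moreover, the Frobenioid `C^un-tr`
(respectively, `(C^un-tr)^pf`) is of model type and may be obtained as the model Frobenioid associated to the
divisor monoid `Φ` (respectively, `Φ^pf`) and the rational function monoid `Φ^birat` (respectively,
`ℚ · Φ^birat = Φ^birat ⊗_ℤ ℚ = (Φ^birat)^pf`)"; Prop. 5.5 (iv) p. 104 ll. 40–44: "a natural equivalence of
categories [compatible with the functors to the respective elementary Frobenioids] between `C^pf` … and the model
Frobenioid associated to the data `Φ^pf, B^pf, B^pf → (Φ^gp)^pf`" (elision marked; the tree identifies `(Φ^gp)^pf`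
with `(Φ^pf)^gp`) [cite: MochizukiFrdI2008, Prop. 5.5 (iv) p.104]; Thm. 5.2 (i) p. 100 (last sentence): "the Frobenius
degree, projection to `D`, and zero divisor determine a functor `C → F_Φ`" [cite: MochizukiFrdI2008, Thm. 5.2 (i) p.100].

PROOF-ONLY sequel (seat abc-iut-L1-d5 gen 6; cell abc-iut, L1 sub-DAG `FrdI-Prop53-Cor54` row **P53/L04**, the
successor item recorded in the gen-5 HANDOFF of this seat).  State of the row in the tree:
* `UnitTrivializationPerfectionModel.lean` / `…Elem.lean` (gens 4/5): `(C^un-tr)^pf ≌ model of (Φ^pf, (Φ^birat)^pf, Div^pf)`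
  over `D` AND over `F_{Φ^pf}` (`PreFrobenioid.exists_untrPf_comparison_elem_overBase`) — for the ABSTRACT perfected
  data `(Φ^birat)^pf = perfectionFunctor Φ^birat`, `Div^pf` any `IsPerfectedDiv` datum;
* `UnitTrivializationPerfectionModelSchema.lean` (gen 4): the DATA IDENTIFICATION with abc-iut-L1-t5's literal rendering
  `ℚ · Φ^birat ⊆ (Φ^pf)^gp` (`GpSubfunctor.perfection`; the model `untrPfModel F = (Φ^birat).PfModelOf`) as an
  equivalence of model Frobenioids over `D` ON THE NOSE (`GpSubfunctor.exists_pfModel_equivalence`), whence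
  `(C^un-tr)^pf ≌ untrPfModel F` over `D` (`exists_untrPf_equiv_untrPfModel`) — over the BASE only.

Here the base-only weakening is removed for the literal data as well:

* §1 `GpSubfunctor.exists_pfModel_equivalence_elem` — the data-identification equivalence
  `model of (Φ^pf, Ψ^pf, Div^pf) ≌ model of (Φ^pf, ℚ · Ψ, incl)` (induced by the morphism of model data
  `(𝟙_{Φ^pf}, Div^pf)` over `𝟭 D`, abc-iut-w5-d048's `DataHomOver.functor`, an equivalence by abc-iut-w5-d137's
  `functor_isEquivalence`) commutes with the structure functors to `F_{Φ^pf}` ON THE NOSE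
  (`T.functor ⋙ toElem = toElem`: its divisor component is `η = 𝟙`, its base component is `𝟭 D`), in particular up
  to a natural isomorphism, and (as before) with the projections to `D`;
* §2 **`PreFrobenioid.exists_untrPf_equiv_untrPfModel_elem`** — for a Frobenioid `C → F_Φ` there is an equivalence
  `(C^un-tr)^pf ≌ untrPfModel F` whose functor, followed by the model's structure functor to `F_{Φ^pf}` (Thm. 5.2 (i)),
  is isomorphic to the structure functor `(C^un-tr)^pf → F_{Φ^pf}` (Prop. 3.2 (i)) AND (by whiskering) lies over `D`
  — binders exactly those of row P53/L04 (`ModelFrobenioid.Hypotheses Φ Φ^birat`, Thm. 5.2's standing hypotheses,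
  and a perfected divisor datum `IsPerfectedDiv`); then the binder-dropped forms of `…Holds.lean`:
  `exists_untrPf_equiv_untrPfModel_elem'` (the datum exists, `exists_isPerfectedDiv`),
  `…_of_biratFSMSurjective` (modulo row P53/L02d only, abc-iut-w5-d137's `untrModel_hypotheses`),
  `…_of_isOfFSMType` (NO binder over a base of FSM-type) and the instance `arith_exists_untrPf_equiv_untrPfModel_elem`
  at THE arithmetic Frobenioid `C_{K/F}` of Ex. 6.3 (closed kernel statement, no hypothesis).

A Frobenioid is a category TOGETHER WITH its functor to `F_Φ` (Def. 1.1 (iv), Def. 1.3); "may be obtained as the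
model Frobenioid" is therefore read — as print spells out in the parallel clause Prop. 5.5 (iv) — as an equivalence
compatible with the structure functors.  abc-iut-L1-t5's typed schema `PreFrobenioid.Prop53_untrPf` asks for the
over-`D` clause only (its perfection datum `PU` is abstract); the statements below are the stronger reading AT THE
constructions and imply the schema's clause (`prop53_untrPf_holds`, unchanged).  No definitions, no new named facts;
nothing is weakened relative to print.  Honest framing: kernel bookkeeping for a refereed 2008 statement ([FrdI]);
nothing here bears on [IUTchIII] Cor. 3.12.
-/

namespace Literature.AlgebraicGeometry.Frobenioids

open CategoryTheory Opposite Function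

universe w v u v' u'

/-! ### §1 The data identification `(Φ^pf, Ψ^pf, Div^pf) → (Φ^pf, ℚ · Ψ, incl)` lies over `F_{Φ^pf}` on the nose -/

namespace ModelFrobenioid.DataHomOver

variable {D : Type u} [Category.{v} D] {Φ' B₁ B₂ : Dᵒᵖ ⥤ CommMonCat.{w}} {DivB₁ : B₁ ⟶ monoidGp Φ'}
  {DivB₂ : B₂ ⟶ monoidGp Φ'}

/-- For a morphism of model data over `𝟭 D` whose divisor-monoid component is the IDENTITY `𝟙_{Φ'}`, the induced
functor of model Frobenioids (abc-iut-w5-d048's `DataHomOver.functor`: `(A, α) ↦ (A, α)`, `(d, f, Div, u) ↦ (d, f, Div, β u)`)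
commutes with the structure functors to `F_{Φ'}` ON THE NOSE: Frobenius degree, base morphism and zero divisor are
untouched (Thm. 5.2 (i): "the Frobenius degree, projection to `D`, and zero divisor determine a functor `C → F_Φ`").
[cite: MochizukiFrdI2008, Thm. 5.2 (i) p.100] -/
theorem functor_comp_toElem_of_eta_eq_id (h : ModelFrobenioid.DataHomOver (𝟭 D) DivB₁ DivB₂) (hη : h.η = 𝟙 Φ') :
    h.functor ⋙ ModelFrobenioid.toElem Φ' B₂ DivB₂ = ModelFrobenioid.toElem Φ' B₁ DivB₁ := by
  obtain ⟨η, β, comm⟩ := h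
  dsimp only at hη
  subst hη
  rfl

end ModelFrobenioid.DataHomOver

namespace GpSubfunctor

variable {D : Type u} [Category.{v} D] {Φ : Dᵒᵖ ⥤ CommMonCat.{w}} (Ψ : GpSubfunctor Φ)
  {DivBpf : perfectionFunctor Ψ.toMonoid ⟶ monoidGp (perfectionFunctor Φ)}

/-- **`model of (Φ^pf, Ψ^pf, Div^pf) ≌ model of (Φ^pf, ℚ · Ψ, incl)`, over `F_{Φ^pf}` AND over `D` on the nose** —
the equivalence of `exists_pfModel_equivalence` (induced by the morphism of model data `(𝟙_{Φ^pf}, Div^pf)` over `𝟭 D`,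
bijective on the rational-function components: `Div^pf` maps `Ψ(A)^pf` bijectively onto `ℚ · Ψ(A)`), now recorded
together with its compatibility with the structure functors to the elementary Frobenioid `F_{Φ^pf}`: the
identification of the datum "`B^pf → (Φ^gp)^pf`" of Prop. 5.5 (iv) (`(Φ^gp)^pf` identified with `(Φ^pf)^gp` in the tree)
with "`ℚ · Φ^birat = Φ^birat ⊗_ℤ ℚ = (Φ^birat)^pf`" of Prop. 5.3, "[compatible with the functors to the respective
elementary Frobenioids]" (Prop. 5.5 (iv)). [cite: MochizukiFrdI2008, Prop. 5.5 (iv) p.104] -/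
theorem exists_pfModel_equivalence_elem (hΦc : ∀ A : Dᵒᵖ, IsCancelMul (Φ.obj A))
    (hDiv : IsPerfectedDiv Φ Ψ.toMonoid Ψ.incl DivBpf) :
    ∃ T : ModelFrobenioid (perfectionFunctor Φ) (perfectionFunctor Ψ.toMonoid) DivBpf ≌ Ψ.PfModelOf,
      T.functor ⋙ ModelFrobenioid.toElem _ _ _ = ModelFrobenioid.toElem _ _ _ ∧
      T.functor ⋙ ModelFrobenioid.baseFunctor _ _ _ = ModelFrobenioid.baseFunctor _ _ _ := by
  let β : perfectionFunctor Ψ.toMonoid ⟶ (𝟭 D).op ⋙ Ψ.perfection.toMonoid :=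
    { app := fun A => CommMonCat.ofHom
        ((divB (perfectionFunctor Φ) (perfectionFunctor Ψ.toMonoid) DivBpf A).codRestrict
          (Ψ.perfection.carrier (unop A)) (Ψ.divBpf_mem_perfection hDiv A))
      naturality := fun A A' f => by
        apply CommMonCat.hom_ext
        ext v
        apply Subtype.ext
        exact (pullGp_divB (Φ := perfectionFunctor Φ) (B := perfectionFunctor Ψ.toMonoid)
          (DivB := DivBpf) f.unop v).symm }
  have comm : ∀ (A : Dᵒᵖ) (u : (perfectionFunctor Ψ.toMonoid).obj A),
      gpApp (𝟙 (perfectionFunctor Φ)) A (divB (perfectionFunctor Φ) (perfectionFunctor Ψ.toMonoid) DivBpf A u) =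
        divB ((𝟭 D).op ⋙ perfectionFunctor Φ) ((𝟭 D).op ⋙ Ψ.perfection.toMonoid)
          (ModelFrobenioid.divBRestrict (𝟭 D) (perfectionFunctor Φ) Ψ.perfection.toMonoid Ψ.perfection.incl) A
          ((β.app A).hom u) := fun A u => by
    change MonGp.map ((𝟙 (perfectionFunctor Φ) : perfectionFunctor Φ ⟶ perfectionFunctor Φ).app A).hom
        (divB (perfectionFunctor Φ) (perfectionFunctor Ψ.toMonoid) DivBpf A u) =
      divB (perfectionFunctor Φ) (perfectionFunctor Ψ.toMonoid) DivBpf A u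
    rw [NatTrans.id_app, CommMonCat.hom_id, MonGp.map_id]
    rfl
  let h : ModelFrobenioid.DataHomOver (𝟭 D) DivBpf Ψ.perfection.incl :=
    { η := 𝟙 (perfectionFunctor Φ), β := β, comm := comm }
  have hη : ∀ X : D, Bijective (h.η.app (op X)).hom := fun X => by
    change Bijective ((𝟙 (perfectionFunctor Φ) : perfectionFunctor Φ ⟶ perfectionFunctor Φ).app (op X)).hom
    rw [NatTrans.id_app, CommMonCat.hom_id]
    exact bijective_id
  have hβ : ∀ X : D, Bijective (h.β.app (op X)).hom := fun X =>
    ⟨fun v₁ v₂ e => Ψ.divBpf_injective hΦc hDiv (op X) (congrArg Subtype.val e), fun y => by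
      obtain ⟨v, hv⟩ := Ψ.exists_divBpf_eq hΦc hDiv (op X) y.2
      exact ⟨v, Subtype.ext hv⟩⟩
  haveI := h.functor_isEquivalence hη hβ
  exact ⟨h.functor.asEquivalence, h.functor_comp_toElem_of_eta_eq_id rfl,
    h.functor_comp_baseFunctor.trans (Functor.comp_id _)⟩

end GpSubfunctor

/-! ### §2 Prop. 5.3 for `(C^un-tr)^pf` AT THE CONSTRUCTIONS, literal data, over `F_{Φ^pf}` -/

namespace PreFrobenioid

variable {D : Type u} [Category.{v} D] {Φ : Dᵒᵖ ⥤ CommMonCat.{w}}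
  {C : Type u'} [Category.{v'} C] {F : C ⥤ ElemFrobenioid Φ}

/-- **[FrdI] Prop. 5.3, `(C^un-tr)^pf` clause, literal data, as an equivalence OF FROBENIOIDS**: for a Frobenioid
`C → F_Φ`, THE perfection of THE unit-trivialisation `(C^un-tr)^pf` is equivalent to the model Frobenioid «associated
to the divisor monoid … `Φ^pf` … and the rational function monoid … `ℚ · Φ^birat = Φ^birat ⊗_ℤ ℚ = (Φ^birat)^pf`»
(elisions marked; `untrPfModel F`) by an equivalence whose functor, followed by the
model's structure functor to `F_{Φ^pf}` (Thm. 5.2 (i)), is isomorphic to the structure functor `(C^un-tr)^pf → F_{Φ^pf}`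
(Prop. 3.2 (i)), AND which lies over `D` — granted Thm. 5.2's standing hypotheses for `(Φ, Φ^birat)` (`h`) and a
perfected divisor datum (`hDiv`), the binders of row P53/L04.  The equivalence is `exists_untrPf_comparison_elem`'s
followed by the data identification of §1. [cite: MochizukiFrdI2008, Prop. 5.3 p.103] -/
theorem exists_untrPf_equiv_untrPfModel_elem (hF : IsFrobenioid F)
    (h : ModelFrobenioid.Hypotheses Φ (biratSubfunctor F).toMonoid)
    (DivBpf : perfectionFunctor (biratSubfunctor F).toMonoid ⟶ monoidGp (perfectionFunctor Φ))
    (hDiv : IsPerfectedDiv Φ (biratSubfunctor F).toMonoid (biratSubfunctor F).incl DivBpf) :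
    ∃ e : Perfection (isFrobenioid_untr hF) ≌ untrPfModel F,
      Nonempty (e.functor ⋙ ModelFrobenioid.toElem _ _ _ ≅ (Perfection.ops (isFrobenioid_untr hF)).toFunctor) ∧
      Nonempty (e.functor ⋙ ModelFrobenioid.baseFunctor _ _ _ ≅ (Perfection.ops (isFrobenioid_untr hF)).base) := by
  obtain ⟨e₀, ⟨j₀⟩, ⟨i₀⟩⟩ := exists_untrPf_comparison_elem_overBase hF h DivBpf hDiv
  obtain ⟨T, hTe, hTb⟩ :=
    (biratSubfunctor F).exists_pfModel_equivalence_elem (isCancelMul_of_isFrobenioid hF) hDiv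
  exact ⟨e₀.trans T,
    ⟨Functor.associator _ _ _ ≪≫ Functor.isoWhiskerLeft e₀.functor (eqToIso hTe) ≪≫ j₀⟩,
    ⟨Functor.associator _ _ _ ≪≫ Functor.isoWhiskerLeft e₀.functor (eqToIso hTb) ≪≫ i₀⟩⟩

/-- The same, the perfected divisor datum no longer a binder (it exists and is unique: `exists_isPerfectedDiv`,
`isPerfectedDiv_unique`; `Φ` is integral objectwise for a Frobenioid). [cite: MochizukiFrdI2008, Prop. 5.3 p.103] -/
theorem exists_untrPf_equiv_untrPfModel_elem' (hF : IsFrobenioid F)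
    (h : ModelFrobenioid.Hypotheses Φ (biratSubfunctor F).toMonoid) :
    ∃ e : Perfection (isFrobenioid_untr hF) ≌ untrPfModel F,
      Nonempty (e.functor ⋙ ModelFrobenioid.toElem _ _ _ ≅ (Perfection.ops (isFrobenioid_untr hF)).toFunctor) ∧
      Nonempty (e.functor ⋙ ModelFrobenioid.baseFunctor _ _ _ ≅ (Perfection.ops (isFrobenioid_untr hF)).base) := by
  obtain ⟨DivBpf, hDiv⟩ := exists_isPerfectedDiv (biratSubfunctor F).incl (isCancelMul_of_isFrobenioid hF)
  exact exists_untrPf_equiv_untrPfModel_elem hF h DivBpf hDiv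

/-- The same, modulo row P53/L02d only (FSM-surjectivity of the pull-backs of `Φ^birat`,
`FrdI.Prop53Sub.BiratFSMSurjective F`; the remaining clauses of Thm. 5.2's hypotheses for `(Φ, Φ^birat)` are carried by
the pre-Frobenioid structure, abc-iut-w5-d137's `untrModel_hypotheses`). [cite: MochizukiFrdI2008, Prop. 5.3 p.103] -/
theorem exists_untrPf_equiv_untrPfModel_elem_of_biratFSMSurjective (hF : IsFrobenioid F)
    (h02d : FrdI.Prop53Sub.BiratFSMSurjective F) :
    ∃ e : Perfection (isFrobenioid_untr hF) ≌ untrPfModel F,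
      Nonempty (e.functor ⋙ ModelFrobenioid.toElem _ _ _ ≅ (Perfection.ops (isFrobenioid_untr hF)).toFunctor) ∧
      Nonempty (e.functor ⋙ ModelFrobenioid.baseFunctor _ _ _ ≅ (Perfection.ops (isFrobenioid_untr hF)).base) :=
  exists_untrPf_equiv_untrPfModel_elem' hF (untrModel_hypotheses F hF.isPreFrobenioid h02d)

/-- **Proposition 5.3 for `(C^un-tr)^pf` over a base of FSM-type, literal data, as an equivalence of Frobenioids,
NO binder left**: for every Frobenioid `C → F_Φ` over a base category `D` of FSM-type, `(C^un-tr)^pf` is equivalent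
to the model Frobenioid of the data (`Φ^pf`, `ℚ · Φ^birat = (Φ^birat)^pf`) (`untrPfModel F`) compatibly
with the structure functors to `F_{Φ^pf}` and with the projections to `D`. [cite: MochizukiFrdI2008, Prop. 5.3 p.103] -/
theorem exists_untrPf_equiv_untrPfModel_elem_of_isOfFSMType (hF : IsFrobenioid F) (hD : IsOfFSMType D) :
    ∃ e : Perfection (isFrobenioid_untr hF) ≌ untrPfModel F,
      Nonempty (e.functor ⋙ ModelFrobenioid.toElem _ _ _ ≅ (Perfection.ops (isFrobenioid_untr hF)).toFunctor) ∧
      Nonempty (e.functor ⋙ ModelFrobenioid.baseFunctor _ _ _ ≅ (Perfection.ops (isFrobenioid_untr hF)).base) :=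
  exists_untrPf_equiv_untrPfModel_elem' hF (untrModel_hypotheses_of_isOfFSMType F hF.isPreFrobenioid hD)

/-- **Prop. 5.3, "Moreover", second half AT THE CONSTRUCTIONS with the elementary-Frobenioid clause**: for the
unit-trivialisation `C^un-tr → F_Φ` (`untrFunctor hF`) and THE perfection datum of `C^un-tr`, `(C^un-tr)^pf` is a
Frobenioid of model type (Def. 4.5 (i), at THE birationalization datum — Prop. 5.5 (iii)) AND there is an equivalence
`(C^un-tr)^pf ⥲ untrPfModel F` compatible with the functors to `F_{Φ^pf}` and lying over `D` — granted Thm. 5.2's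
standing hypotheses for `(Φ, Φ^birat)`; the conjunction of which abc-iut-L1-t5's schema `Prop53_untrPf` (over-`D` clause
only, `prop53_untrPf_holds'`) is the projection. [cite: MochizukiFrdI2008, Prop. 5.3 p.103] -/
theorem prop53_untrPf_elem_holds (hF : IsFrobenioid F)
    (h : ModelFrobenioid.Hypotheses Φ (biratSubfunctor F).toMonoid) :
    (∃ (hS : IsFrobenioid (Perfection.ops (isFrobenioid_untr hF)).toFunctor)
        (hsq : HasBiratSquares (Perfection.ops (isFrobenioid_untr hF)).toFunctor),
        IsOfModelType (Perfection.ops (isFrobenioid_untr hF)).toFunctor hS hsq) ∧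
      ∃ e : Perfection (isFrobenioid_untr hF) ≌ untrPfModel F,
        Nonempty (e.functor ⋙ ModelFrobenioid.toElem _ _ _ ≅ (Perfection.ops (isFrobenioid_untr hF)).toFunctor) ∧
        Nonempty (e.functor ⋙ ModelFrobenioid.baseFunctor _ _ _ ≅ (Perfection.ops (isFrobenioid_untr hF)).base) :=
  ⟨(prop53_untrPf_holds' hF h hF).1, exists_untrPf_equiv_untrPfModel_elem' hF h⟩

end PreFrobenioid

/-! ### Instance: THE arithmetic Frobenioid `C_{K/F}` (Ex. 6.3) -/

section Arith

variable (F : Type) [Field F] [NumberField F] (K : Type) [Field K] [Algebra F K] [IsGalois F K]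

/-- **Prop. 5.3 for `(C_{K/F}^un-tr)^pf`, literal data, as an equivalence of Frobenioids, no hypothesis**: for THE
arithmetic Frobenioid `C_{K/F}` of Ex. 6.3 (`K/F` a Galois extension of number fields; base `FinSubextCat F K` of
FSM-type, abc-iut-L6-t10's `arithFrobenioid_isFrobenioid`), `(C^un-tr)^pf` is equivalent to the model Frobenioid of
`(Φ^pf, ℚ · Φ^birat)` compatibly with the functors to `F_{Φ^pf}` and with the projections to `D`.
[cite: MochizukiFrdI2008, Thm. 6.4 (i) p.115] -/
theorem arith_exists_untrPf_equiv_untrPfModel_elem :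
    ∃ e : PreFrobenioid.Perfection (PreFrobenioid.isFrobenioid_untr (arithFrobenioid_isFrobenioid F K)) ≌
        PreFrobenioid.untrPfModel
          (ModelFrobenioid.toElem (arithDivisorFunctor F K) (unitsFunctor F K) (divNatTrans F K)),
      Nonempty (e.functor ⋙ ModelFrobenioid.toElem _ _ _ ≅
        (PreFrobenioid.Perfection.ops (PreFrobenioid.isFrobenioid_untr (arithFrobenioid_isFrobenioid F K))).toFunctor) ∧
      Nonempty (e.functor ⋙ ModelFrobenioid.baseFunctor _ _ _ ≅
        (PreFrobenioid.Perfection.ops (PreFrobenioid.isFrobenioid_untr (arithFrobenioid_isFrobenioid F K))).base) :=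
  PreFrobenioid.exists_untrPf_equiv_untrPfModel_elem_of_isOfFSMType (arithFrobenioid_isFrobenioid F K)
    (FinSubextCat.isOfFSMType F K)

end Arith

end Literature.AlgebraicGeometry.Frobenioids
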